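import Summits.Schanuel.Schanuel.Theorems.RootDecomp1KHyper53

/-!
# RootDecomp1KHyper — lens 6, generation 17 «BILOG STAIRCASE CELL» (BilogStair.lean edition 2 f0528a77…, 2567 l) — continuation (RootDecomp1KHyper54): §B the ALGEBRAIC ENDGAME; §C the cell: `hgt`, `HyperStair`, `gam`, the UNDECIDED pieces `TransferI` / `TransferII` (Prop defs) and the reduction `sb_three_of_transfer`-shape theorems

(lens-6 g17 `BilogStair.lean` edition 2, sha256 f0528a77…5850, own farm rc 0 · 0 sorry · axioms std; critic ACK STATUS L1737 PORT GO LOW (registered, no credit);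
port by census-1 gen 15 in ten parts `RootDecomp1KHyper53`–`62` — see the PORT NOTE of part 53; `--supports stmt-Schanuel-33363`; rung 0.)
-/

open Complex Polynomial IntermediateField Filter
open scoped BigOperators

namespace Summit.Schanuel.Schanuel.Theorems.RootDecomp1KHyper

namespace HyperCell

namespace LatCell

namespace Bilog

/-! ## §B  The ALGEBRAIC ENDGAME

`Flat a b Y₁ Y₂`: the points `(a_k, b_k)` approach `(Y₁, Y₂)` from below and are, frequently, flat of every order
in the second direction relative to the first (a STAIRCASE).  `DegGrowth γ`: the algebraic numbers `γ_k` have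
degree `→ ∞`.  Then no fixed non-zero `F ∈ ℤ[T, a, b]` vanishes at `(γ_k, a_k, b_k)` for all large `k`. -/

/-- The staircase property of `(a_k, b_k) → (Y₁, Y₂)`. -/
def Flat (a b : ℕ → ℚ) (Y₁ Y₂ : ℝ) : Prop :=
  ∀ (M : ℕ) (δ : ℝ), 0 < δ → ∃ᶠ k in atTop,
    0 < Y₁ - a k ∧ Y₁ - a k < δ ∧ 0 < Y₂ - b k ∧ Y₂ - b k ≤ (Y₁ - a k) ^ M

/-- Degree growth of a sequence of complex numbers: eventually no non-zero rational polynomial of degree `≤ D`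
vanishes at `γ_k`. -/
def DegGrowth (γ : ℕ → ℂ) : Prop :=
  ∀ D : ℕ, ∀ᶠ k in atTop, ∀ f : ℚ[X], f ≠ 0 → f.natDegree ≤ D → Polynomial.aeval (γ k) f ≠ 0

/-- The specialisation `F(T, p, q) ∈ ℚ[T]` of `F ∈ ℤ[T, a, b]` at rational `a = p`, `b = q`. -/
noncomputable def specT (F : MvPolynomial (Fin 3) ℤ) (p q : ℚ) : ℚ[X] :=
  MvPolynomial.aeval ![(Polynomial.X : ℚ[X]), Polynomial.C p, Polynomial.C q] F

/-- Evaluating the specialisation: `F(T, p, q)(γ) = F(γ, p, q)`. -/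
theorem aeval_specT {A : Type*} [CommRing A] [Algebra ℚ A] (F : MvPolynomial (Fin 3) ℤ) (p q : ℚ)
    (γ : A) : Polynomial.aeval γ (specT F p q) =
      MvPolynomial.aeval ![γ, algebraMap ℚ A p, algebraMap ℚ A q] F := by
  unfold specT
  have h := DFunLike.congr_fun (MvPolynomial.comp_aeval (R := ℤ)
    ((Polynomial.aeval γ : ℚ[X] →ₐ[ℚ] A).toRingHom.toIntAlgHom)
    (f := ![(Polynomial.X : ℚ[X]), Polynomial.C p, Polynomial.C q])) F
  have hfun : (fun i => (Polynomial.aeval γ : ℚ[X] →ₐ[ℚ] A).toRingHom.toIntAlgHom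
      (![(Polynomial.X : ℚ[X]), Polynomial.C p, Polynomial.C q] i)) =
      ![γ, algebraMap ℚ A p, algebraMap ℚ A q] := by
    funext i
    match i with
    | 0 => simp
    | 1 => simp
    | 2 => simp
  rw [hfun] at h
  exact h

/-- The `T`-degree of the specialisation is at most the `T`-degree of `F`. -/
theorem natDegree_specT_le (F : MvPolynomial (Fin 3) ℤ) (p q : ℚ) :
    (specT F p q).natDegree ≤ F.support.sup (fun s => s 0) := by
  classical
  unfold specT
  conv_lhs => rw [MvPolynomial.as_sum F]
  rw [map_sum]
  refine Polynomial.natDegree_sum_le_of_forall_le _ _ fun s hs => ?_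
  rw [MvPolynomial.aeval_monomial, Finsupp.prod_pow, Fin.prod_univ_three]
  simp only [Matrix.cons_val_zero, Matrix.cons_val_one, Matrix.cons_val_two, Matrix.head_cons,
    Matrix.tail_cons, eq_intCast, ← Polynomial.C_pow]
  refine natDegree_mul_le.trans ?_
  rw [natDegree_intCast, zero_add]
  refine natDegree_mul_le.trans ?_
  rw [natDegree_C, add_zero]
  refine natDegree_mul_le.trans ?_
  rw [natDegree_C, add_zero, natDegree_X_pow]
  exact Finset.le_sup (f := fun s : Fin 3 →₀ ℕ => s 0) hs

/-- A non-zero integer polynomial has an integer non-root. -/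
theorem exists_eval_ne_zero {n : ℕ} (F : MvPolynomial (Fin n) ℤ) (hF : F ≠ 0) :
    ∃ x : Fin n → ℤ, MvPolynomial.eval x F ≠ 0 := by
  by_contra hall
  push Not at hall
  exact hF (MvPolynomial.funext fun x => by rw [hall x, map_zero])

/-- Composition of integer substitutions. -/
theorem aeval_aeval_int {σ τ : Type*} {A : Type*} [CommRing A] (w : σ → MvPolynomial τ ℤ) (y : τ → A)
    (F : MvPolynomial σ ℤ) :
    MvPolynomial.aeval y (MvPolynomial.aeval w F) = MvPolynomial.aeval (fun i => MvPolynomial.aeval y (w i)) F :=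
  DFunLike.congr_fun (MvPolynomial.comp_aeval (R := ℤ) (MvPolynomial.aeval y) (f := w)) F

/-- Evaluation after a polynomial substitution with coefficients in `A`. -/
theorem eval_aeval_int {σ τ : Type*} {A : Type*} [CommRing A] (w : σ → MvPolynomial τ A) (y : τ → A)
    (g : MvPolynomial σ ℤ) :
    MvPolynomial.eval y (MvPolynomial.aeval w g) =
      MvPolynomial.aeval (fun i => MvPolynomial.eval y (w i)) g :=
  DFunLike.congr_fun (MvPolynomial.comp_aeval (R := ℤ) (MvPolynomial.eval y).toIntAlgHom (f := w)) g

/-- Evaluation at an integer point, cast. -/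
theorem aeval_intCast_eq {σ : Type*} {A : Type*} [CommRing A] (x : σ → ℤ) (g : MvPolynomial σ ℤ) :
    MvPolynomial.aeval (fun i => (x i : A)) g = ((MvPolynomial.eval x g : ℤ) : A) := by
  have h := DFunLike.congr_fun
    (MvPolynomial.comp_aeval (R := ℤ) (Int.castRingHom A).toIntAlgHom (f := x)) g
  simp only [AlgHom.comp_apply] at h
  exact h.symm

/-- **Algebraic endgame.**  Along a staircase with degree growth, no fixed non-zero `F ∈ ℤ[T, a, b]` vanishes at
`(γ_k, a_k, b_k)` for all large `k`. -/
theorem algEndgame {a b : ℕ → ℚ} {Y₁ Y₂ : ℝ} {γ : ℕ → ℂ} (hflat : Flat a b Y₁ Y₂) (hdeg : DegGrowth γ)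
    (F : MvPolynomial (Fin 3) ℤ) (hF : F ≠ 0)
    (hz : ∀ᶠ k in atTop, MvPolynomial.aeval ![γ k, (a k : ℂ), (b k : ℂ)] F = 0) : False := by
  classical
  -- Step 1: the specialisations `F(T, a_k, b_k)` vanish identically for all large `k`.
  have hspec : ∀ᶠ k in atTop, specT F (a k) (b k) = 0 := by
    filter_upwards [hdeg (F.support.sup (fun s => s 0)), hz] with k hk hk0
    by_contra hne
    refine hk _ hne (natDegree_specT_le F _ _) ?_
    rw [aeval_specT]
    simpa using hk0
  -- Step 2: an integer `τ = x 0` with `g := F(τ, ·, ·) ≠ 0`.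
  obtain ⟨x, hx⟩ := exists_eval_ne_zero F hF
  obtain ⟨g, hg⟩ : ∃ g : MvPolynomial (Fin 2) ℤ,
      g = MvPolynomial.aeval ![MvPolynomial.C (x 0), MvPolynomial.X 0, MvPolynomial.X 1] F := ⟨_, rfl⟩
  have hgF : ∀ {A : Type} [CommRing A] (s t : A), MvPolynomial.aeval ![s, t] g =
      MvPolynomial.aeval ![((x 0 : ℤ) : A), s, t] F := by
    intro A _ s t
    rw [hg, aeval_aeval_int]
    have hfun : (fun i => MvPolynomial.aeval ![s, t]
        (![MvPolynomial.C (x 0), MvPolynomial.X 0, MvPolynomial.X 1] i)) = ![((x 0 : ℤ) : A), s, t] := by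
      funext i
      match i with
      | 0 => simp
      | 1 => simp
      | 2 => simp
    rw [hfun]
  have hg0 : g ≠ 0 := by
    intro h0
    apply hx
    have h1 := hgF (A := ℚ) ((x 1 : ℤ) : ℚ) ((x 2 : ℤ) : ℚ)
    rw [h0, map_zero] at h1
    have h2 := aeval_intCast_eq (A := ℚ) x F
    have hxv : (fun i => ((x i : ℤ) : ℚ)) = ![((x 0 : ℤ) : ℚ), ((x 1 : ℤ) : ℚ), ((x 2 : ℤ) : ℚ)] := by
      funext i
      match i with
      | 0 => simp
      | 1 => simp
      | 2 => simp
    rw [hxv, ← h1] at h2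
    exact_mod_cast h2.symm
  -- Step 3: `g(a_k, b_k) = 0` for all large `k`.
  have hgz : ∀ᶠ k in atTop, MvPolynomial.aeval ![(a k : ℝ), (b k : ℝ)] g = 0 := by
    filter_upwards [hspec] with k hk
    have h2 := aeval_specT F (a k) (b k) ((x 0 : ℤ) : ℝ)
    rw [hk, map_zero] at h2
    rw [hgF]
    simpa using h2.symm
  -- Step 4: the staircase lemma for `h(u, v) := g(Y₁ - u, Y₂ - v)`.
  obtain ⟨h, hh⟩ : ∃ h : MvPolynomial (Fin 2) ℝ,
      h = MvPolynomial.aeval ![MvPolynomial.C Y₁ - MvPolynomial.X 0, MvPolynomial.C Y₂ - MvPolynomial.X 1] g :=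
    ⟨_, rfl⟩
  have hev : ∀ u v : ℝ, MvPolynomial.eval ![u, v] h = MvPolynomial.aeval ![Y₁ - u, Y₂ - v] g := by
    intro u v
    rw [hh, eval_aeval_int]
    have hfun : (fun i => MvPolynomial.eval ![u, v]
        (![MvPolynomial.C Y₁ - MvPolynomial.X 0, MvPolynomial.C Y₂ - MvPolynomial.X 1] i)) =
        ![Y₁ - u, Y₂ - v] := by
      funext i
      match i with
      | 0 => simp
      | 1 => simp
    rw [hfun]
  have hh0 : h ≠ 0 := by
    intro h0
    obtain ⟨x', hx'⟩ := exists_eval_ne_zero g hg0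
    have h1 := hev (Y₁ - x' 0) (Y₂ - x' 1)
    rw [h0, map_zero, sub_sub_cancel, sub_sub_cancel] at h1
    have h2 := aeval_intCast_eq (A := ℝ) x' g
    have hxv : (fun i => ((x' i : ℤ) : ℝ)) = ![((x' 0 : ℤ) : ℝ), ((x' 1 : ℤ) : ℝ)] := by
      funext i
      match i with
      | 0 => simp
      | 1 => simp
    rw [hxv, ← h1] at h2
    exact hx' (by exact_mod_cast h2.symm)
  obtain ⟨M, δ, hδ, hstair⟩ := staircase_eval_ne_zero h hh0
  obtain ⟨k, ⟨h1, h2, h3, h4⟩, hk⟩ := ((hflat M δ hδ).and_eventually hgz).exists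
  refine hstair (Y₁ - a k) (Y₂ - b k) h1 h2 h3 h4 ?_
  rw [hev, sub_sub_cancel, sub_sub_cancel]
  exact hk

/-! ## §C  The cell: `HyperStair`, the algebraic points `γ_k`, the two TRANSFER pieces and the REDUCTION

Data of the cell: a real `ℓ` with `e^{iℓ}` algebraic (a point of the unit circle), rational sequences `a, b`,
and a real `y` hyper-approximated by the lattice points `r_k = a_k π + b_k ℓ`.  The points
`γ_k = e^{i r_k} = e^{iπ a_k} · (e^{iℓ})^{b_k}` are ALGEBRAIC (roots of unity times rational powers of `α`). -/

/-- The height of the `k`-th approximant: `1 + den a_k + den b_k + |num a_k| + |num b_k|`. -/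
def hgt (a b : ℕ → ℚ) (k : ℕ) : ℝ :=
  1 + ((a k).den : ℝ) + ((b k).den : ℝ) + |((a k).num : ℝ)| + |((b k).num : ℝ)|

/-- The staircase height is at least `1`. -/
theorem one_le_hgt (a b : ℕ → ℚ) (k : ℕ) : 1 ≤ hgt a b k := by
  unfold hgt
  have h1 : (0 : ℝ) ≤ ((a k).den : ℝ) := by positivity
  have h2 : (0 : ℝ) ≤ ((b k).den : ℝ) := by positivity
  have h3 : (0 : ℝ) ≤ |((a k).num : ℝ)| := abs_nonneg _
  have h4 : (0 : ℝ) ≤ |((b k).num : ℝ)| := abs_nonneg _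
  linarith

/-- `y` is hyper-approximated along the lattice points `a_k π + b_k ℓ`: error `< exp(-H_k^m)` for every `m`,
eventually in `k`. -/
def HyperStair (ℓ y : ℝ) (a b : ℕ → ℚ) : Prop :=
  ∀ m : ℕ, ∀ᶠ k in atTop, |y - ((a k : ℝ) * Real.pi + (b k : ℝ) * ℓ)| < Real.exp (-(hgt a b k) ^ m)

/-- The algebraic points `γ_k = exp(i (a_k π + b_k ℓ))`. -/
noncomputable def gam (ℓ : ℝ) (a b : ℕ → ℚ) (k : ℕ) : ℂ :=
  cexp ((((a k : ℝ) * Real.pi + (b k : ℝ) * ℓ : ℝ) : ℂ) * I)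

/-- **TRANSFER I** (piece, UNDECIDED — Case I of the dichotomy: `π, ℓ` algebraically independent).
Two integer relations `G₁(π, ℓ, y) = 0` and `G₂(π, ℓ, e^{iy}) = 0` transfer, along the hyper-approximation
`y ≈ a_k π + b_k ℓ`, `e^{iy} ≈ γ_k`, to ONE exact relation `F(γ_k, a_k, b_k) = 0` for all large `k`.
Blueprint (port of the torsion/Kummer resultant engine + one new step): `P_k := E^d G₁(x₁, x₂, a_k x₁ + b_k x₂)`,
`P'_k := Res_T(G₂(x₁, x₂, T), Ψ_k(T))` with `Ψ_k` the minimal polynomial of `γ_k`, `R := Res_{x₂}(P_k, P'_k) ∈ ℤ[x₁]`;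
`|R(π)| ≤ exp(poly(H_k)) · exp(-H_k^m)` contradicts the Nesterenko–Waldschmidt measure of `π` (tree-PROVED) unless
`R ≡ 0`, i.e. a common factor, i.e. (conjugate transfer via `minpoly.dvd`) an exact relation `F(γ_k, a_k, b_k) = 0`
with `F` from the finite list of `ℚ`-closed proper exceptional loci of `G₁, G₂`. -/
def TransferI : Prop :=
  ∀ (ℓ y : ℝ) (a b : ℕ → ℚ), IsAlgebraic ℚ (cexp ((ℓ : ℂ) * I)) → HyperStair ℓ y a b →
    DegGrowth (gam ℓ a b) → (∀ᶠ k in atTop, 0 < b k) →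
    AlgebraicIndependent ℚ ![(Real.pi : ℂ), (ℓ : ℂ)] →
    ∀ G₁ G₂ : MvPolynomial (Fin 3) ℤ, G₁ ≠ 0 → G₂ ≠ 0 →
      MvPolynomial.aeval ![(Real.pi : ℂ), (ℓ : ℂ), (y : ℂ)] G₁ = 0 →
      MvPolynomial.aeval ![(Real.pi : ℂ), (ℓ : ℂ), cexp ((y : ℂ) * I)] G₂ = 0 →
      ∃ F : MvPolynomial (Fin 3) ℤ, F ≠ 0 ∧
        ∀ᶠ k in atTop, MvPolynomial.aeval ![gam ℓ a b k, (a k : ℂ), (b k : ℂ)] F = 0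

/-- **TRANSFER II** (piece, UNDECIDED — Case II of the dichotomy: an exact integer relation `Φ(π, ℓ) = 0`).
One integer relation `G(π, y, e^{iy}) = 0` transfers to an exact relation `F(γ_k, a_k, b_k) = 0` for all large `k`.
Blueprint: `P_k := E^d G(x₁, a_k x₁ + b_k x₂, T)`, `R₁ := Res_T(P_k, Ψ_k) ∈ ℤ[x₁, x₂]`, `R₂ := Res_{x₂}(R₁, Φ) ∈ ℤ[x₁]`
(eliminating `x₂` against the EXACT zero `Φ(π, ℓ) = 0`); `|R₂(π)|` hyper-small contradicts the measure of `π`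
unless `R₂ ≡ 0`, whence (generic point of the curve `Φ = 0`, conjugate transfer) an exact `F(γ_k, a_k, b_k) = 0`.
Here `e^{iy}` is LOAD-BEARING: with `trdeg ℚ(π, ℓ) = 1` both `y` and `e^{iy}` must contribute. -/
def TransferII : Prop :=
  ∀ (ℓ y : ℝ) (a b : ℕ → ℚ), IsAlgebraic ℚ (cexp ((ℓ : ℂ) * I)) → HyperStair ℓ y a b →
    DegGrowth (gam ℓ a b) → (∀ᶠ k in atTop, 0 < b k) →
    ∀ Φ : MvPolynomial (Fin 2) ℤ, Φ ≠ 0 → MvPolynomial.aeval ![(Real.pi : ℂ), (ℓ : ℂ)] Φ = 0 →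
    ∀ G : MvPolynomial (Fin 3) ℤ, G ≠ 0 →
      MvPolynomial.aeval ![(Real.pi : ℂ), (y : ℂ), cexp ((y : ℂ) * I)] G = 0 →
      ∃ F : MvPolynomial (Fin 3) ℤ, F ≠ 0 ∧
        ∀ᶠ k in atTop, MvPolynomial.aeval ![gam ℓ a b k, (a k : ℂ), (b k : ℂ)] F = 0

/-- Integer relations from algebraic dependence (contrapositive of the tree lemma
`HyperCell.algebraicIndependent_of_forall_int`). -/
theorem exists_int_relation {n : ℕ} {θ : Fin n → ℂ} (h : ¬ AlgebraicIndependent ℚ θ) :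
    ∃ G : MvPolynomial (Fin n) ℤ, G ≠ 0 ∧ MvPolynomial.aeval θ G = 0 := by
  by_contra hall
  push Not at hall
  exact h (algebraicIndependent_of_forall_int hall)

/-- **REDUCTION (PROVED).**  The two transfer pieces decide the BILOG STAIRCASE CELL:
`SB 3 (iπ, iℓ, iy)`, i.e. `trdeg ℚ(π, ℓ, y, e^{iy}, …) ≥ 3`, uniformly in the unknown `trdeg ℚ(π, ℓ)`. -/
theorem sb_three_of_transfer (hI : TransferI) (hII : TransferII) {ℓ y Y₁ Y₂ : ℝ} {a b : ℕ → ℚ}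
    (halg : IsAlgebraic ℚ (cexp ((ℓ : ℂ) * I))) (hS : HyperStair ℓ y a b)
    (hdeg : DegGrowth (gam ℓ a b)) (hb : ∀ᶠ k in atTop, 0 < b k) (hflat : Flat a b Y₁ Y₂) :
    SB 3 ![(Real.pi : ℂ) * I, (ℓ : ℂ) * I, (y : ℂ) * I] := by
  -- the θ-free dichotomy: one of three triples is algebraically independent
  have key : AlgebraicIndependent ℚ ![(Real.pi : ℂ), (ℓ : ℂ), (y : ℂ)] ∨
      AlgebraicIndependent ℚ ![(Real.pi : ℂ), (ℓ : ℂ), cexp ((y : ℂ) * I)] ∨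
      AlgebraicIndependent ℚ ![(Real.pi : ℂ), (y : ℂ), cexp ((y : ℂ) * I)] := by
    by_contra hnot
    push Not at hnot
    obtain ⟨h1, h2, h3⟩ := hnot
    by_cases hAI : AlgebraicIndependent ℚ ![(Real.pi : ℂ), (ℓ : ℂ)]
    · obtain ⟨G₁, hG₁, h1'⟩ := exists_int_relation h1
      obtain ⟨G₂, hG₂, h2'⟩ := exists_int_relation h2
      obtain ⟨F, hF, hz⟩ := hI ℓ y a b halg hS hdeg hb hAI G₁ G₂ hG₁ hG₂ h1' h2'
      exact algEndgame hflat hdeg F hF hz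
    · obtain ⟨Φ, hΦ, hΦ0⟩ := exists_int_relation hAI
      obtain ⟨G, hG, h3'⟩ := exists_int_relation h3
      obtain ⟨F, hF, hz⟩ := hII ℓ y a b halg hS hdeg hb Φ hΦ hΦ0 G hG h3'
      exact algEndgame hflat hdeg F hF hz
  -- memberships in `adjoin ℚ (SFset z ∪ {I})`
  have hIm : I ∈ adjoin ℚ (SFset ![(Real.pi : ℂ) * I, (ℓ : ℂ) * I, (y : ℂ) * I] ∪ {I}) :=
    subset_adjoin _ _ (Or.inr rfl)
  have hdivI : ∀ w : ℂ, w * I ∈ adjoin ℚ (SFset ![(Real.pi : ℂ) * I, (ℓ : ℂ) * I, (y : ℂ) * I] ∪ {I}) →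
      w ∈ adjoin ℚ (SFset ![(Real.pi : ℂ) * I, (ℓ : ℂ) * I, (y : ℂ) * I] ∪ {I}) := by
    intro w hw
    have e : w = -((w * I) * I) := by rw [mul_assoc, I_mul_I]; ring
    rw [e]
    exact neg_mem (mul_mem hw hIm)
  have hπ : (Real.pi : ℂ) ∈ adjoin ℚ (SFset ![(Real.pi : ℂ) * I, (ℓ : ℂ) * I, (y : ℂ) * I] ∪ {I}) :=
    hdivI _ (subset_adjoin _ _ (Or.inl (Or.inl ⟨0, by simp⟩)))
  have hℓ : (ℓ : ℂ) ∈ adjoin ℚ (SFset ![(Real.pi : ℂ) * I, (ℓ : ℂ) * I, (y : ℂ) * I] ∪ {I}) :=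
    hdivI _ (subset_adjoin _ _ (Or.inl (Or.inl ⟨1, by simp⟩)))
  have hy : (y : ℂ) ∈ adjoin ℚ (SFset ![(Real.pi : ℂ) * I, (ℓ : ℂ) * I, (y : ℂ) * I] ∪ {I}) :=
    hdivI _ (subset_adjoin _ _ (Or.inl (Or.inl ⟨2, by simp⟩)))
  have he : cexp ((y : ℂ) * I) ∈ adjoin ℚ (SFset ![(Real.pi : ℂ) * I, (ℓ : ℂ) * I, (y : ℂ) * I] ∪ {I}) :=
    subset_adjoin _ _ (Or.inl (Or.inr ⟨2, by simp⟩))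
  rcases key with h | h | h
  · exact sb_of_algebraicIndependent h (by simp) fun i =>
      match i with
      | 0 => hπ
      | 1 => hℓ
      | 2 => hy
  · exact sb_of_algebraicIndependent h (by simp) fun i =>
      match i with
      | 0 => hπ
      | 1 => hℓ
      | 2 => he
  · exact sb_of_algebraicIndependent h (by simp) fun i =>
      match i with
      | 0 => hπ
      | 1 => hy
      | 2 => he

end Bilog
end LatCell
end HyperCell
end Summit.Schanuel.Schanuel.Theorems.RootDecomp1KHyper
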